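import Summits.HodgeConjecture.HodgeConjecture.Theorems.AnchorTransportAnchorExistenceK3SquareCMFloorTranscendental
import Summits.HodgeConjecture.HodgeConjecture.Theorems.AnchorTransportAnchorExistenceK3SquareCMFloorSignature

/-!
# Route AnchorTransport — `AnchorExistence` (stmt-HodgeConjecture-1077), line `Sketch`, CM floor:
# the transcendental Hodge structure is polarized and irreducible

Marking picture, sequel to `…CMFloorTranscendental` (the weight-two Hodge structure `hodgeT` of K3
type on `T = N^⊥ ≤ Λ_ℚ` defined by a period `x`, `N` the rational `(1,1)`-vectors with
`N ∩ N^⊥ = 0`). THIS FILE: (1) the POLARIZATION `ψ = -( . )|_T` of `hodgeT` (Huybrechts,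
*Lectures on K3 Surfaces*, Ch. 3 §1.2 Def. 1.6 and §3.3.5: "`⟨ , ⟩ := -ψ`"; first Hodge–Riemann
relation `(ω.ω) = 0`, `T^{1,1} ⊥ ω`; second: `(x.x̄) > 0` on `T^{2,0} ⊕ T^{0,2}` and `( . )`
negative definite on `T^{1,1}` — the signature computation `re_k3Form_self_star_neg` of
`…CMFloorSignature`, which consumes an ample vector `u ∈ N`, `(u.u) > 0`); (2) IRREDUCIBILITY of
`hodgeT` (Ch. 3 Lemma 3.1: "If `X` is projective, then `T(X)` is a polarizable irreducible Hodge
structure"; proof: a sub-Hodge structure containing `ω` after complexification has orthogonal in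
`T` made of rational `(1,1)`-vectors, hence `0`; one not containing `ω` is orthogonal to `x̄`,
hence made of rational `(1,1)`-vectors, hence `0`). So Zarhin's theorems of the tree apply to `T`.

## References

* [Huybrechts2016K3] D. Huybrechts, Lectures on K3 Surfaces, CUP 2016, Ch. 3 §1.2 Def. 1.6,
  Lemma 3.2.7, Lemma 3.3.1, §3.3.5.
* [VoisinHodgeI2002] C. Voisin, Hodge Theory and Complex Algebraic Geometry I, CUP 2002, §7.1.2.
-/

noncomputable section

set_option linter.dupNamespace false

open scoped TensorProduct
open Module
open Literature.AlgebraicGeometry.Surfaces Literature.AlgebraicGeometry.Motives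
open Literature.AlgebraicGeometry.Motives.HodgeStructure
open Summit.HodgeConjecture.HodgeConjecture.Theorems.NikulinTwinTransport

namespace Summit.HodgeConjecture.HodgeConjecture.Theorems.AnchorExistenceCMFloor

/-! ### The polarization `-( . )|_T` -/

section Polarization

variable {x : K3Index → ℂ} {N : Submodule ℚ (K3Index → ℚ)}

/-- The base change of `-B` is `-(B_ℂ)`. [folklore] -/
theorem neg_baseChange_apply {V : Type*} [AddCommGroup V] [Module ℚ V] (B : LinearMap.BilinForm ℚ V)
    (z z' : ℂ ⊗[ℚ] V) : (-B).baseChange ℂ z z' = -(B.baseChange ℂ z z') := by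
  induction z using TensorProduct.induction_on with
  | zero => rw [map_zero, LinearMap.zero_apply, map_zero, LinearMap.zero_apply, neg_zero]
  | tmul c v =>
    induction z' using TensorProduct.induction_on with
    | zero => rw [map_zero, map_zero, neg_zero]
    | tmul c' v' =>
      rw [LinearMap.BilinForm.baseChange_tmul, LinearMap.BilinForm.baseChange_tmul, LinearMap.neg_apply,
        LinearMap.neg_apply, neg_smul]
    | add a b ha hb => rw [map_add, map_add, ha, hb, neg_add]
  | add a b ha hb => rw [map_add, LinearMap.add_apply, map_add, LinearMap.add_apply, ha, hb, neg_add]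

/-- The restricted form is symmetric. [folklore] -/
theorem restrict_symm (T : Submodule ℚ (K3Index → ℚ)) (a b : T) :
    k3FormRat.restrict T a b = k3FormRat.restrict T b a := by
  rw [LinearMap.BilinForm.restrict_apply, LinearMap.BilinForm.restrict_apply, LinearMap.domRestrict_apply,
    LinearMap.domRestrict_apply, k3FormRat_isSymm.eq]

/-- **`T_ℂ ⊥ N`**: `(ι_T z . n) = 0` for `n ∈ N`, `T = N^⊥`. [cite: Huybrechts2016K3, Ch. 3 Lemma 3.3.1] -/
theorem k3Form_iota_of_mem (z : ℂ ⊗[ℚ] (k3FormRat.orthogonal N)) {n : K3Index → ℚ} (hn : n ∈ N) :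
    k3Form (iota _ z) (fun i => (n i : ℂ)) = 0 := by
  induction z using TensorProduct.induction_on with
  | zero => rw [map_zero, k3Form_zero_left]
  | tmul c t =>
    rw [iota_tmul, k3Form_smul_left, k3Form_ratCast, k3FormRat_isSymm.eq,
      (LinearMap.BilinForm.mem_orthogonal_iff.1 t.2) n hn, Rat.cast_zero, mul_zero]
  | add a b ha hb => rw [map_add, k3Form_add_left, ha, hb, add_zero]

/-- Far from the diagonal the pieces of the transcendental Hodge structure vanish: for
`p + q = 2` with `(p, q) ∉ {(2,0), (1,1), (0,2)}` one has `|p - q| > 2`. [folklore] -/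
theorem two_lt_abs_sub {p q : ℤ} (hpq : p + q = 2) (h20 : p ≠ 2) (h11 : p ≠ 1) (h02 : p ≠ 0) :
    2 < |p - q| := by
  rcases le_or_gt p (-1) with h | h
  · rw [abs_sub_comm]
    exact lt_of_lt_of_le (by omega) (le_abs_self _)
  · exact lt_of_lt_of_le (by omega) (le_abs_self _)

/-- **The polarization of the transcendental Hodge structure** by `ψ = -( . )|_T`
(Huybrechts §3.3.5: "`⟨ , ⟩ := -ψ( , )` … positive definite on `(T^{2,0} ⊕ T^{0,2})_ℝ`, negative
definite on `T^{1,1}_ℝ`"; in the tree's untwisted convention `i^{p-q} ψ_ℂ(z, z̄) > 0`): the first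
Hodge–Riemann relation is `(ω.ω) = 0`, `T^{1,1} ⊥ ω`; the second is `(x.x̄) > 0` on `T^{2,0}`,
`T^{0,2}` and the negativity of `( . )` on `T^{1,1}` (`re_k3Form_self_star_neg`, which consumes
the ample vector `u`). [cite: Huybrechts2016K3, Ch. 3 §1.2 Def. 1.6, Lemma 3.3.1 and §3.3.5] -/
def polT (hN : ∀ v : K3Index → ℚ, v ∈ N ↔
      k3Form (fun i => (v i : ℂ)) x = 0 ∧ k3Form (fun i => (v i : ℂ)) (star x) = 0)
    (hdisj : Disjoint N (k3FormRat.orthogonal N)) (hxx : k3Form x x = 0)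
    (hxpos : 0 < (k3Form (star x) x).re)
    (hu : ∃ u : K3Index → ℤ, k3Form (fun i => (u i : ℂ)) x = 0 ∧ 0 < ∑ i, ∑ j, u i * k3Gram i j * u j) :
    (hodgeT hN hdisj hxx hxpos).Polarization where
  form := -(k3FormRat.restrict (k3FormRat.orthogonal N))
  flip_form := by
    rw [show (2 : ℤ).negOnePow = 1 from Int.negOnePow_even 2 even_two, Units.val_one, one_smul]
    refine LinearMap.ext fun v => LinearMap.ext fun w => ?_
    rw [LinearMap.BilinForm.flip_apply, LinearMap.neg_apply, LinearMap.neg_apply, LinearMap.neg_apply,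
      LinearMap.neg_apply, restrict_symm]
  form_apply_eq_zero := by
    intro p z hz z' hz'
    rw [neg_baseChange_apply, neg_eq_zero]
    change z ∈ periodF _ (omega x hdisj) p at hz
    change z' ∈ periodF _ (omega x hdisj) (2 + 1 - p) at hz'
    by_cases hp0 : p ≤ 0
    · rw [periodF_of_three_le _ _ (by omega), Submodule.mem_bot] at hz'
      rw [hz', map_zero]
    by_cases hp1 : p = 1
    · subst hp1
      rw [show (2 : ℤ) + 1 - 1 = 2 by norm_num, mem_periodF_two] at hz'
      obtain ⟨c, rfl⟩ := hz'
      rw [mem_periodF_one] at hz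
      rw [map_smul, smul_eq_mul, form_baseChange_symm (restrict_symm _) z, hz, mul_zero]
    by_cases hp2 : p = 2
    · subst hp2
      rw [mem_periodF_two] at hz
      obtain ⟨c, rfl⟩ := hz
      rw [show (2 : ℤ) + 1 - 2 = 1 by norm_num, mem_periodF_one] at hz'
      rw [LinearMap.map_smul₂, smul_eq_mul, hz', mul_zero]
    · rw [periodF_of_three_le _ _ (by omega), Submodule.mem_bot] at hz
      rw [hz, LinearMap.map_zero₂]
  pos := by
    intro p q hpq z hz hz0
    obtain ⟨hre, hne⟩ := k3Form_self_star_period hxpos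
    have hB : ∀ a b : ℂ ⊗[ℚ] (k3FormRat.orthogonal N),
        (-(k3FormRat.restrict (k3FormRat.orthogonal N))).baseChange ℂ a b = -k3Form (iota _ a) (iota _ b) :=
      fun a b => by rw [neg_baseChange_apply, restrict_baseChange_apply]
    by_cases h20 : p = 2
    · subst h20
      obtain rfl : q = 0 := by omega
      obtain ⟨c, rfl⟩ := (mem_piece_two_zero_ofPeriod _ _).1 hz
      have hc : c ≠ 0 := by
        rintro rfl
        exact hz0 (zero_smul _ _)
      refine ⟨Complex.normSq c * (k3Form (star x) x).re, mul_pos (Complex.normSq_pos.2 hc) hxpos, ?_⟩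
      rw [hB, conj_smul, map_smul, map_smul, k3Form_smul_left, k3Form_smul_right, iota_omega hN hdisj,
        iota_conj_omega hN hdisj, hre, zpow_two, Complex.I_mul_I, zpow_zero, inv_one, mul_one, Complex.ofReal_mul,
        ← Complex.mul_conj]
      ring
    by_cases h02 : p = 0
    · subst h02
      obtain rfl : q = 2 := by omega
      obtain ⟨c, rfl⟩ := (mem_piece_zero_two_ofPeriod _ _).1 hz
      have hc : c ≠ 0 := by
        rintro rfl
        exact hz0 (zero_smul _ _)
      refine ⟨Complex.normSq c * (k3Form (star x) x).re, mul_pos (Complex.normSq_pos.2 hc) hxpos, ?_⟩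
      have hre' : k3Form (star x) x = ((k3Form (star x) x).re : ℂ) := by rw [← hre, k3Form_comm]
      rw [hB, conj_smul, conj_conj, map_smul, map_smul, k3Form_smul_left, k3Form_smul_right, iota_omega hN hdisj,
        iota_conj_omega hN hdisj, hre', zpow_two, Complex.I_mul_I, zpow_zero, Complex.ofReal_mul,
        ← Complex.mul_conj, Complex.ofReal_re]
      ring
    by_cases h11 : p = 1
    · subst h11
      obtain rfl : q = 1 := by omega
      obtain ⟨hz1, hz2⟩ := (mem_piece_one_one_ofPeriod _ _).1 hz
      rw [restrict_baseChange_apply, iota_omega hN hdisj] at hz1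
      rw [restrict_baseChange_apply, iota_conj_omega hN hdisj] at hz2
      set v := iota _ z with hv
      have hv0 : v ≠ 0 := fun h0 => hz0 (iota_injective _ (by rw [← hv, h0, map_zero]))
      obtain ⟨u, hux, hupos⟩ := hu
      have huQ : (fun i => ((u i : ℚ) : ℚ)) ∈ N := by
        rw [hN, ← intCast_eq_ratCast_intCast]
        exact ⟨hux, k3Form_ratCast_star_eq_zero (u := fun i => (u i : ℚ)) (by rw [← intCast_eq_ratCast_intCast]; exact hux)⟩
      have hvu : k3Form v (fun i => (u i : ℂ)) = 0 := by
        rw [intCast_eq_ratCast_intCast]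
        exact k3Form_iota_of_mem z huQ
      have hneg := re_k3Form_self_star_neg hxx hxpos hux hupos (by rw [k3Form_comm, hz1]) (by rw [k3Form_comm, hz2])
        hvu hv0
      refine ⟨-(k3Form v (star v)).re, by linarith, ?_⟩
      have hvv : k3Form v (star v) = ((k3Form v (star v)).re : ℂ) := by
        apply Complex.ext
        · simp
        · simp [im_k3Form_self_star]
      rw [hB, ← hv, iota_conj, ← hv, zpow_one, mul_inv_cancel₀ Complex.I_ne_zero, one_mul]
      conv_rhs => rw [Complex.ofReal_neg, ← hvv]
    · exfalso
      have hbot := (isOfK3Type_hodgeT hN hdisj hxx hxpos).2 p q (two_lt_abs_sub hpq h20 h11 h02)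
      rw [hbot, Submodule.mem_bot] at hz
      exact hz0 hz

end Polarization

/-! ### Irreducibility (Huybrechts, Ch. 3 Lemma 3.1) -/

section Irreducible

variable {x : K3Index → ℂ} {N : Submodule ℚ (K3Index → ℚ)}

/-- For a subspace `S ≤ T`, `ι_T (S_ℂ)` lies in the complex span of `S`. [folklore] -/
theorem iota_baseChange_subtype_mem_span {T : Submodule ℚ (K3Index → ℚ)} (S : Submodule ℚ T)
    (w : ℂ ⊗[ℚ] S) :
    iota T (S.subtype.baseChange ℂ w) ∈
      Submodule.span ℂ (Set.range fun s : S => fun i => (((s : T) : K3Index → ℚ) i : ℂ)) := by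
  induction w using TensorProduct.induction_on with
  | zero => rw [map_zero, map_zero]; exact Submodule.zero_mem _
  | tmul c s =>
    rw [LinearMap.baseChange_tmul, iota_tmul]
    exact Submodule.smul_mem _ _ (Submodule.subset_span ⟨s, rfl⟩)
  | add a b ha hb => rw [map_add, map_add]; exact Submodule.add_mem _ ha hb

/-- A rational vector orthogonal over `ℚ` to `S` is orthogonal over `ℂ` to the complex span of `S`.
[folklore] -/
theorem k3Form_eq_zero_of_mem_span {T : Submodule ℚ (K3Index → ℚ)} (S : Submodule ℚ T)
    {t : K3Index → ℚ} (ht : ∀ s : S, k3FormRat t ((s : T) : K3Index → ℚ) = 0) {z : K3Index → ℂ}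
    (hz : z ∈ Submodule.span ℂ (Set.range fun s : S => fun i => (((s : T) : K3Index → ℚ) i : ℂ))) :
    k3Form (fun i => (t i : ℂ)) z = 0 := by
  induction hz using Submodule.span_induction with
  | mem z hz =>
    obtain ⟨s, rfl⟩ := hz
    rw [k3Form_ratCast, ht s, Rat.cast_zero]
  | zero => exact k3Form_zero_right _
  | add a b _ _ ha hb => rw [k3Form_add_right, ha, hb, add_zero]
  | smul c z _ h => rw [k3Form_smul_right, h, mul_zero]

/-- A rational vector orthogonal to `x̄` is orthogonal to `x`. [folklore] -/
theorem k3Form_ratCast_eq_zero_of_star {v : K3Index → ℚ} (h : k3Form (fun i => (v i : ℂ)) (star x) = 0) :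
    k3Form (fun i => (v i : ℂ)) x = 0 := by
  have h' := k3Form_ratCast_star_eq_zero h
  rwa [star_star] at h'

/-- **Huybrechts, Ch. 3 Lemma 3.1: the transcendental Hodge structure of a projective K3 surface is
irreducible.** For a sub-Hodge structure `S ≤ T`: if `ω ∈ S_ℂ` then every `t ∈ T` orthogonal to `S`
is orthogonal to `x` and `x̄`, hence a rational `(1,1)`-vector, `t ∈ N ∩ T = 0`, so `S = T` by
non-degeneracy; if `ω ∉ S_ℂ` then `S_ℂ ∩ F² = 0`, so by opposedness `S_ℂ ⊆ x̄^⊥`, i.e. `S ⊆ N`,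
`S = 0`. [cite: Huybrechts2016K3, Ch. 3 Lemma 3.3.1 and Lemma 3.2.7] -/
theorem isIrreducible_hodgeT (hN : ∀ v : K3Index → ℚ, v ∈ N ↔
      k3Form (fun i => (v i : ℂ)) x = 0 ∧ k3Form (fun i => (v i : ℂ)) (star x) = 0)
    (hdisj : Disjoint N (k3FormRat.orthogonal N)) (hxx : k3Form x x = 0)
    (hxpos : 0 < (k3Form (star x) x).re) : (hodgeT hN hdisj hxx hxpos).IsIrreducible := by
  refine ⟨?_, fun W => ?_⟩
  · rw [Submodule.nontrivial_iff_ne_bot]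
    intro hbot
    apply omega_ne_zero hN hdisj hxpos
    have hall : ∀ z : ℂ ⊗[ℚ] (k3FormRat.orthogonal N), z = 0 := fun z => by
      induction z using TensorProduct.induction_on with
      | zero => rfl
      | tmul c t =>
        have ht : t = 0 := by
          apply Subtype.ext
          rw [Submodule.coe_zero]
          exact (Submodule.mem_bot ℚ).1 (hbot.le t.2)
        rw [ht, TensorProduct.tmul_zero]
      | add a b ha hb => rw [ha, hb, add_zero]
    exact hall _
  · set S := W.toSubmodule with hS
    have hj : Function.Injective (S.subtype.baseChange ℂ) := by
      rw [LinearMap.baseChange_eq_ltensor]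
      exact Module.Flat.lTensor_preserves_injective_linearMap _ S.injective_subtype
    by_cases hω : omega x hdisj ∈ LinearMap.range (S.subtype.baseChange ℂ)
    · -- `ω ∈ S_ℂ`: then `S = T`
      right
      obtain ⟨w, hw⟩ := hω
      have hxspan : x ∈ Submodule.span ℂ
          (Set.range fun s : S => fun i => (((s : k3FormRat.orthogonal N) : K3Index → ℚ) i : ℂ)) := by
        rw [← iota_omega hN hdisj, ← hw]
        exact iota_baseChange_subtype_mem_span S w
      have horth : (k3FormRat.restrict (k3FormRat.orthogonal N)).orthogonal S = ⊥ := by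
        rw [eq_bot_iff]
        intro t ht
        rw [LinearMap.BilinForm.mem_orthogonal_iff] at ht
        have ht' : ∀ s : S, k3FormRat (t : K3Index → ℚ) ((s : k3FormRat.orthogonal N) : K3Index → ℚ) = 0 :=
          fun s => by
            have h := ht s s.2
            rw [LinearMap.BilinForm.restrict_apply, LinearMap.domRestrict_apply] at h
            rw [k3FormRat_isSymm.eq]
            exact h
        have h1 : k3Form (fun i => ((t : K3Index → ℚ) i : ℂ)) x = 0 := k3Form_eq_zero_of_mem_span S ht' hxspan
        have htN : (t : K3Index → ℚ) ∈ N := (hN _).2 ⟨h1, k3Form_ratCast_star_eq_zero h1⟩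
        have ht0 : (t : K3Index → ℚ) = 0 := Submodule.disjoint_def.1 hdisj _ htN t.2
        rw [Submodule.mem_bot]
        exact Subtype.ext ht0
      have hfin := LinearMap.BilinForm.finrank_orthogonal (restrict_orthogonal_nondegenerate hdisj) S
      rw [horth, finrank_bot] at hfin
      have hle := Submodule.finrank_le S
      exact Submodule.eq_top_of_finrank_eq (by omega)
    · -- `ω ∉ S_ℂ`: then `S = 0`
      left
      have hF2 : ((hodgeT hN hdisj hxx hxpos).F 2).comap (S.subtype.baseChange ℂ) = ⊥ := by
        rw [eq_bot_iff]
        intro w hw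
        rw [Submodule.mem_comap] at hw
        change S.subtype.baseChange ℂ w ∈ periodF (k3FormRat.restrict (k3FormRat.orthogonal N)) (omega x hdisj) 2 at hw
        rw [mem_periodF_two] at hw
        obtain ⟨c, hc⟩ := hw
        by_cases hc0 : c = 0
        · rw [hc0, zero_smul] at hc
          rw [Submodule.mem_bot]
          exact hj (by rw [← hc, map_zero])
        · exfalso
          apply hω
          refine ⟨c⁻¹ • w, ?_⟩
          rw [map_smul, ← hc, smul_smul, inv_mul_cancel₀ hc0, one_smul]
      have htop : (complexConj ((hodgeT hN hdisj hxx hxpos).F 1)).comap (S.subtype.baseChange ℂ) = ⊤ := by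
        have h := (W.isCompl 2 1 (by norm_num)).sup_eq_top
        rwa [← hS, hF2, bot_sup_eq] at h
      rw [eq_bot_iff]
      intro s hs
      have hmem : (1 : ℂ) ⊗ₜ[ℚ] (⟨s, hs⟩ : S) ∈
          (complexConj ((hodgeT hN hdisj hxx hxpos).F 1)).comap (S.subtype.baseChange ℂ) := by
        rw [htop]; exact Submodule.mem_top
      rw [Submodule.mem_comap, LinearMap.baseChange_tmul, Submodule.subtype_apply] at hmem
      change (1 : ℂ) ⊗ₜ[ℚ] s ∈ complexConj (periodF (k3FormRat.restrict (k3FormRat.orthogonal N)) (omega x hdisj) 1) at hmem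
      rw [mem_complexConj_periodF_one, restrict_baseChange_apply, iota_conj_omega hN hdisj, iota_one_tmul,
        k3Form_comm] at hmem
      have h1 : k3Form (fun i => ((s : K3Index → ℚ) i : ℂ)) x = 0 := k3Form_ratCast_eq_zero_of_star hmem
      have hsN : (s : K3Index → ℚ) ∈ N := (hN _).2 ⟨h1, hmem⟩
      have hs0 : (s : K3Index → ℚ) = 0 := Submodule.disjoint_def.1 hdisj _ hsN s.2
      rw [Submodule.mem_bot]
      exact Subtype.ext hs0

end Irreducible

end Summit.HodgeConjecture.HodgeConjecture.Theorems.AnchorExistenceCMFloor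

end
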